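import Mathlib
import Summits.Ventures.HSemireg.ApolarGramEven

/-!
# Venture HSemireg — apolar Gram matrix: the SIGN LAW at even `ρ` (THEOREM A′, sign part, complete)

HONEST FRAMING. Finite-dimensional real linear algebra, the discrete Fourier transform on `ZMod N`
and elementary trigonometry only; no variety / sheaf / semiregularity map; nothing here says that
HC / HC_CM / HC_AV holds; no Literature fact is declared or assumed.

Fifth file of the apolar chain (after `ApolarGramCirculant` / `ApolarGramEven`) (cell pub-hsemireg, FORMULA-N PART A §2.9 =
theory/th6/apolar/APOLAR-GRAM-RANK-th6g8.md §1 (f)). For `n` even, `ρ = 2u` even, `2 ≤ ρ ≤ n + 1`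
and distinct increasing real atoms: **`sign det ((x_i − x_j)^n)_{i,j<ρ} = (−1)^u`**, i.e. the
determinant is negative iff `ρ ≡ 2 (mod 4)` (`det_gram_sign_even`; with `det_gram_pos_odd` of
`ApolarGramEven` this is the sign part of THEOREM A′ in full). Proof as printed in §1 (f): by sign
constancy (`det_gram_pos_of_pos_at`) it suffices to know the sign at the cot configuration, whose
Gram matrix is `D · circulant(v) · D`, `v_m = sin^n(π m/ρ)`; for `ρ = 2u` the real DFT values pair
off except `λ_0 = Σ v > 0` and the UNPAIRED value `λ_u = Σ_m (−1)^m sin^n(πm/ρ)`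
(`prod_eq_of_even_evenN`), and `λ_u = (−1)^u · 4^{−n/2} · ρ · Σ_{j ≤ n, ρ ∣ j − n/2 − u} C(n, j)`
(`dft_middle_eq`: `sin² = (2 − e(m) − e(−m))/4 = −e(−m)(1 − e(m))²/4`, binomial expansion,
orthogonality of characters; every surviving `j` has the parity of `n/2 + u`), a sum containing
`C(n, n/2 + u) > 0`.

Also: `apolarGram_rank` — THEOREM A packaged in one statement (all `n ≥ 1`, `1 ≤ ρ ≤ n + 1`:
rank `= ρ − [ρ = 1]` for `n` even, `= 2⌊ρ/2⌋` for `n` odd), with `rank_gram_one`.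

NOT here: the inertia law `n₋ = ⌊ρ/2⌋ + [ρ ≡ 3 (mod 4)]` (Cauchy interlacing).
-/

noncomputable section

open Finset ZMod
open scoped BigOperators ComplexConjugate

namespace Summit.Ventures.HSemireg.ApolarGram

variable {N : ℕ} [NeZero N]

/-- `e(m) + e(−m) = 2 cos(2π m/N)`. -/
theorem stdAddChar_add_stdAddChar_neg (m : ZMod N) :
    (stdAddChar m : ℂ) + stdAddChar (-m) =
      ((2 * Real.cos (2 * Real.pi * (m.val : ℝ) / N) : ℝ) : ℂ) := by
  have hm : (stdAddChar m : ℂ) = Complex.exp (((2 * Real.pi * (m.val : ℝ) / N : ℝ) : ℂ) * Complex.I) := by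
    conv_lhs => rw [← ZMod.natCast_zmod_val m]
    rw [show ((m.val : ℕ) : ZMod N) = ((m.val : ℤ) : ZMod N) by simp, stdAddChar_coe]
    congr 1
    push_cast
    ring
  have hneg : (stdAddChar (-m) : ℂ) = Complex.exp (-(((2 * Real.pi * (m.val : ℝ) / N : ℝ) : ℂ) * Complex.I)) := by
    rw [AddChar.map_neg_eq_inv, hm, Complex.exp_neg]
  rw [hm, hneg, show -(((2 * Real.pi * (m.val : ℝ) / N : ℝ) : ℂ) * Complex.I) =
      ((-(2 * Real.pi * (m.val : ℝ) / N) : ℝ) : ℂ) * Complex.I by push_cast; ring,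
    Complex.exp_mul_I, Complex.exp_mul_I]
  simp only [Complex.ofReal_neg, Complex.cos_neg, Complex.sin_neg, ← Complex.ofReal_cos,
    ← Complex.ofReal_sin]
  push_cast
  ring

/-- `sin²(π m/N) = (2 − e(m) − e(−m))/4` as complex numbers. -/
theorem sin_sq_eq_stdAddChar (m : ZMod N) :
    ((Real.sin (Real.pi * (m.val : ℝ) / N) ^ 2 : ℝ) : ℂ) =
      (2 - (stdAddChar m : ℂ) - stdAddChar (-m)) / 4 := by
  have h := stdAddChar_add_stdAddChar_neg m
  have hcos : Real.sin (Real.pi * (m.val : ℝ) / N) ^ 2 =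
      (2 - 2 * Real.cos (2 * Real.pi * (m.val : ℝ) / N)) / 4 := by
    rw [Real.sin_sq, Real.cos_sq]
    rw [show 2 * (Real.pi * (m.val : ℝ) / N) = 2 * Real.pi * (m.val : ℝ) / N by ring]
    ring
  rw [hcos, sub_sub, h]
  push_cast
  ring
/-- `2 − e(m) − e(−m) = −e(−m) (1 − e(m))²`. -/
theorem two_sub_eq (m : ZMod N) :
    (2 : ℂ) - stdAddChar m - stdAddChar (-m) = -stdAddChar (-m) * (1 - stdAddChar m) ^ 2 := by
  have h1 : (stdAddChar (-m) : ℂ) * stdAddChar m = 1 := by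
    rw [← AddChar.map_add_eq_mul, neg_add_cancel, AddChar.map_zero_eq_one]
  have h2 : (stdAddChar (-m) : ℂ) * (stdAddChar m) ^ 2 = stdAddChar m := by
    rw [sq, ← mul_assoc, h1, one_mul]
  linear_combination (-2 : ℂ) * h1 + h2
/-- `(1 − e(m))^{2p} = Σ_j (−1)^j C(2p,j) e(j m)`. -/
theorem one_sub_pow_eq (m : ZMod N) (p : ℕ) :
    (1 - (stdAddChar m : ℂ)) ^ (2 * p) =
      ∑ j ∈ range (2 * p + 1), (-1 : ℂ) ^ j * ((2 * p).choose j : ℂ) * stdAddChar ((j : ZMod N) * m) := by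
  rw [sub_eq_neg_add, add_pow]
  refine Finset.sum_congr rfl fun j _ => ?_
  rw [one_pow, mul_one, neg_pow, ← AddChar.map_nsmul_eq_pow, nsmul_eq_mul]
  ring

/-- the index set of surviving binomials: `J = {j ≤ 2p : N ∣ j − p − u}`. -/
def survJ (N u p : ℕ) : Finset ℕ :=
  (range (2 * p + 1)).filter fun j => (N : ℤ) ∣ ((j : ℤ) - p - u)
/-- `p + u ∈ J` when `u ≤ p`. -/
theorem mem_survJ_self {u p : ℕ} (hup : u ≤ p) : p + u ∈ survJ (2 * u) u p := by
  simp only [survJ, mem_filter, mem_range]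
  exact ⟨by omega, ⟨0, by push_cast; ring⟩⟩

/-- **the unpaired DFT value in closed form**: for `N = 2u ≥ 2` and `v_m = sin^{2p}(π m/N)`,
`𝓕 v (u) = (−1)^u · 4^{−p} · N · Σ_{j ∈ J} C(2p, j)`. -/
theorem dft_middle_eq {u : ℕ} (hN : N = 2 * u) (p : ℕ) :
    𝓕 (fun m : ZMod N => ((Real.sin (Real.pi * (m.val : ℝ) / N) ^ (2 * p) : ℝ) : ℂ)) (u : ZMod N) =
      (-1 : ℂ) ^ u * (((4 : ℝ)⁻¹ ^ p * N * ∑ j ∈ survJ N u p, ((2 * p).choose j : ℝ) : ℝ) : ℂ) := by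
  set e : ZMod N → ℂ := fun x => (stdAddChar x : ℂ) with he
  set u' : ZMod N := (u : ZMod N) with hu'
  -- the summands
  have hv : ∀ m : ZMod N, ((Real.sin (Real.pi * (m.val : ℝ) / N) ^ (2 * p) : ℝ) : ℂ) =
      (-1 : ℂ) ^ p * (4 : ℂ)⁻¹ ^ p * e (-m) ^ p * (1 - e m) ^ (2 * p) := by
    intro m
    rw [pow_mul, Complex.ofReal_pow, sin_sq_eq_stdAddChar, two_sub_eq, div_eq_mul_inv, mul_pow,
      mul_pow, neg_pow, ← pow_mul]
    simp only [he]; ring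
  have hterm : ∀ m : ZMod N, (stdAddChar (-(m * u')) : ℂ) * ((Real.sin (Real.pi * (m.val : ℝ) / N) ^ (2 * p) : ℝ) : ℂ) =
      (-1 : ℂ) ^ p * (4 : ℂ)⁻¹ ^ p * ∑ j ∈ range (2 * p + 1),
        (-1 : ℂ) ^ j * ((2 * p).choose j : ℂ) * e (((j : ZMod N) - p - u') * m) := by
    intro m
    rw [hv m, one_sub_pow_eq m p, Finset.mul_sum, Finset.mul_sum, Finset.mul_sum]
    refine Finset.sum_congr rfl fun j _ => ?_
    have hexp : (stdAddChar (-(m * u')) : ℂ) * (e (-m) ^ p * stdAddChar ((j : ZMod N) * m)) =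
        e (((j : ZMod N) - p - u') * m) := by
      simp only [he]
      rw [← AddChar.map_nsmul_eq_pow, ← AddChar.map_add_eq_mul, ← AddChar.map_add_eq_mul]
      congr 1
      rw [nsmul_eq_mul]; ring
    rw [← hexp]
    simp only [he]; ring
  -- the DFT value
  rw [dft_apply]
  simp_rw [smul_eq_mul, hterm]
  rw [← Finset.mul_sum, Finset.sum_comm]
  -- inner sums over m: orthogonality
  have hinner : ∀ j ∈ range (2 * p + 1),
      ∑ m : ZMod N, (-1 : ℂ) ^ j * ((2 * p).choose j : ℂ) * e (((j : ZMod N) - p - u') * m) =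
        if (N : ℤ) ∣ ((j : ℤ) - p - u) then (-1 : ℂ) ^ j * ((2 * p).choose j : ℂ) * N else 0 := by
    intro j _
    rw [← Finset.mul_sum]
    simp only [he]
    rw [sum_stdAddChar_mul]
    have hcast : ((j : ZMod N) - p - u') = (((j : ℤ) - p - u : ℤ) : ZMod N) := by
      simp [hu']
    by_cases hdvd : (N : ℤ) ∣ ((j : ℤ) - p - u)
    · have ht : ((j : ZMod N) - p - u') = 0 := by
        rw [hcast]; exact (ZMod.intCast_zmod_eq_zero_iff_dvd _ _).2 hdvd
      rw [if_pos ht, if_pos hdvd]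
    · have ht : ((j : ZMod N) - p - u') ≠ 0 := fun h =>
        hdvd ((ZMod.intCast_zmod_eq_zero_iff_dvd _ _).1 (by rw [← hcast]; exact h))
      rw [if_neg ht, if_neg hdvd, mul_zero]
  rw [Finset.sum_congr rfl hinner, ← Finset.sum_filter]
  -- on the surviving j: (−1)^j = (−1)^(p+u)
  have hsign : ∀ j ∈ survJ N u p, (-1 : ℂ) ^ j = (-1) ^ (p + u) := by
    intro j hj
    simp only [survJ, mem_filter, mem_range] at hj
    obtain ⟨-, c, hc⟩ := hj
    have heven : Even (j + p + u) := by
      have h2 : Even (((j + p + u : ℕ) : ℤ)) := by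
        refine ⟨u * c + p + u, ?_⟩
        rw [hN] at hc; push_cast at hc ⊢; linarith
      exact (Int.even_coe_nat _).1 h2
    have h1 : (-1 : ℂ) ^ j * (-1) ^ (p + u) = 1 := by
      rw [← pow_add, show j + (p + u) = j + p + u by ring]; exact heven.neg_one_pow
    have h5 : (-1 : ℂ) ^ (p + u) * (-1) ^ (p + u) = 1 := by
      rw [← pow_add, ← two_mul]; exact (even_two_mul _).neg_one_pow
    calc (-1 : ℂ) ^ j = (-1) ^ j * ((-1) ^ (p + u) * (-1) ^ (p + u)) := by rw [h5, mul_one]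
      _ = ((-1) ^ j * (-1) ^ (p + u)) * (-1) ^ (p + u) := by ring
      _ = (-1) ^ (p + u) := by rw [h1, one_mul]
  change (-1 : ℂ) ^ p * (4 : ℂ)⁻¹ ^ p *
      ∑ j ∈ survJ N u p, (-1 : ℂ) ^ j * ((2 * p).choose j : ℂ) * (N : ℂ) = _
  rw [Finset.sum_congr rfl fun j hj => by rw [hsign j hj], ← Finset.sum_mul, ← Finset.mul_sum]
  have hpp : (-1 : ℂ) ^ p * (-1) ^ p = 1 := by
    rw [← pow_add, ← two_mul]; exact (even_two_mul _).neg_one_pow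
  push_cast
  rw [pow_add]
  linear_combination ((-1 : ℂ) ^ u * (4 : ℂ)⁻¹ ^ p * (N : ℂ) *
    ∑ j ∈ survJ N u p, ((2 * p).choose j : ℂ)) * hpp

/-- **sign of the unpaired DFT value**: `(−1)^u · 𝓕 v (u)` is a positive real (`1 ≤ u ≤ p`). -/
theorem dft_middle_sign {u p : ℕ} (hN : N = 2 * u) (hup : u ≤ p) :
    ∃ c : ℝ, 0 < c ∧
      𝓕 (fun m : ZMod N => ((Real.sin (Real.pi * (m.val : ℝ) / N) ^ (2 * p) : ℝ) : ℂ)) (u : ZMod N) =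
        (-1 : ℂ) ^ u * (c : ℂ) := by
  refine ⟨(4 : ℝ)⁻¹ ^ p * N * ∑ j ∈ survJ N u p, ((2 * p).choose j : ℝ), ?_, dft_middle_eq hN p⟩
  have hNpos : (0 : ℝ) < N := by exact_mod_cast Nat.pos_of_ne_zero (NeZero.ne N)
  have hsum : 0 < ∑ j ∈ survJ N u p, ((2 * p).choose j : ℝ) := by
    have hmem : p + u ∈ survJ N u p := by rw [hN]; exact mem_survJ_self hup
    calc (0 : ℝ) < ((2 * p).choose (p + u) : ℝ) := by
          exact_mod_cast Nat.choose_pos (by omega)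
      _ ≤ ∑ j ∈ survJ N u p, ((2 * p).choose j : ℝ) :=
          Finset.single_le_sum (f := fun j => ((2 * p).choose j : ℝ)) (fun j _ => by positivity) hmem
  positivity


/-! ### Pairing on `ZMod (2u)`: the product of an even function -/

/-- on `ZMod N`, `N = 2u`, an even function has `∏_k f k = f 0 · f u · (∏_{1 ≤ k ≤ u−1} f k)²`. -/
theorem prod_eq_of_even_evenN {u : ℕ} (hN : N = 2 * u) (hu : 1 ≤ u) (f : ZMod N → ℝ)
    (heven : ∀ k, f (-k) = f k) :
    ∏ k, f k = f 0 * f (u : ZMod N) *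
      ((∏ k ∈ (univ : Finset (ZMod N)).filter (fun k => 1 ≤ k.val ∧ k.val ≤ u - 1), f k) *
       ∏ k ∈ (univ : Finset (ZMod N)).filter (fun k => 1 ≤ k.val ∧ k.val ≤ u - 1), f k) := by
  classical
  set S : Finset (ZMod N) := univ.filter fun k => 1 ≤ k.val ∧ k.val ≤ u - 1 with hS
  set u' : ZMod N := (u : ZMod N) with hu'
  have hval_neg : ∀ k : ZMod N, k ≠ 0 → (-k).val = N - k.val := by
    intro k hk; rw [ZMod.neg_val, if_neg hk]
  have hu'val : u'.val = u := by
    rw [hu', ZMod.val_natCast]; exact Nat.mod_eq_of_lt (by omega)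
  have hu'0 : u' ≠ 0 := by
    intro h; have := congrArg ZMod.val h; rw [hu'val, ZMod.val_zero] at this; omega
  have hmemS : ∀ k : ZMod N, k ∈ S ↔ 1 ≤ k.val ∧ k.val ≤ u - 1 := fun k => by simp [hS]
  -- univ.erase 0 = {u'} ∪ (S ∪ S.image neg)
  have hsplit : (univ : Finset (ZMod N)).erase 0 = insert u' (S ∪ S.image Neg.neg) := by
    ext k
    rw [mem_erase, mem_insert, mem_union, mem_image, hmemS]
    constructor
    · rintro ⟨hk, -⟩
      have hkv : 1 ≤ k.val := Nat.one_le_iff_ne_zero.2 (fun h => hk ((ZMod.val_eq_zero k).1 h))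
      have hlt : k.val < N := ZMod.val_lt k
      by_cases hku : k.val = u
      · left
        apply ZMod.val_injective N
        rw [hku, hu'val]
      by_cases hle : k.val ≤ u - 1
      · exact Or.inr (Or.inl ⟨hkv, hle⟩)
      · refine Or.inr (Or.inr ⟨-k, ?_, neg_neg k⟩)
        rw [hmemS, hval_neg k hk]
        omega
    · rintro (rfl | ⟨h1, -⟩ | ⟨k', hk', rfl⟩)
      · exact ⟨hu'0, mem_univ _⟩
      · refine ⟨fun h => ?_, mem_univ _⟩
        rw [h, ZMod.val_zero] at h1; omega
      · rw [hmemS] at hk'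
        refine ⟨fun h => ?_, mem_univ _⟩
        have : k' = 0 := by rw [← neg_neg k', h, neg_zero]
        rw [this, ZMod.val_zero] at hk'; omega
  have hdisj : Disjoint S (S.image Neg.neg) := by
    rw [Finset.disjoint_left]
    rintro k hk hk'
    rw [hmemS] at hk
    rw [mem_image] at hk'
    obtain ⟨k', hk'S, rfl⟩ := hk'
    rw [hmemS] at hk'S
    have hk'0 : k' ≠ 0 := by intro h; rw [h, ZMod.val_zero] at hk'S; omega
    rw [hval_neg k' hk'0] at hk
    have := ZMod.val_lt k'
    omega
  have hu'notin : u' ∉ S ∪ S.image Neg.neg := by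
    rw [mem_union, mem_image, hmemS, hu'val]
    rintro (⟨-, h⟩ | ⟨k', hk', hk'u⟩)
    · omega
    · rw [hmemS] at hk'
      have hk'0 : k' ≠ 0 := by intro h; rw [h, ZMod.val_zero] at hk'; omega
      have := congrArg ZMod.val hk'u
      rw [hval_neg k' hk'0, hu'val] at this
      omega
  rw [← Finset.mul_prod_erase univ f (mem_univ 0), hsplit, Finset.prod_insert hu'notin,
    Finset.prod_union hdisj, Finset.prod_image fun a _ b _ h => neg_injective h]
  have : ∏ k ∈ S, f (-k) = ∏ k ∈ S, f k := Finset.prod_congr rfl fun k _ => heven k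
  rw [this]; ring


/-! ### Assembly: the sign at the cot configuration, then everywhere -/

/-- the unpaired DFT value of the `sinSeq` generator, `k + 1 = 2u ≤ 2p + 1`. -/
theorem dft_sinSeq_middle {k u p : ℕ} (hk : k + 1 = 2 * u) (hup : u ≤ p) :
    ∃ c : ℝ, 0 < c ∧
      (𝓕 (fun m : ZMod (k + 1) => (sinSeq k (2 * p) m : ℂ)) (u : ZMod (k + 1))).re = (-1) ^ u * c := by
  obtain ⟨c, hc, hmid⟩ := dft_middle_sign (N := k + 1) (u := u) (p := p) hk hup
  refine ⟨c, hc, ?_⟩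
  have hfun : (fun m : ZMod (k + 1) => (sinSeq k (2 * p) m : ℂ)) =
      fun m : ZMod (k + 1) => ((Real.sin (Real.pi * (m.val : ℝ) / ((k + 1 : ℕ) : ℝ)) ^ (2 * p) : ℝ) : ℂ) := by
    funext m; rw [sinSeq, Nat.cast_succ]
  rw [hfun, hmid]
  have : ((-1 : ℂ) ^ u * (c : ℂ)) = (((-1 : ℝ) ^ u * c : ℝ) : ℂ) := by push_cast; ring
  rw [this, Complex.ofReal_re]

/-- the real DFT values of `sinSeq` form an even function. -/
theorem dft_sinSeq_re_even (k n : ℕ) (j : ZMod (k + 1)) :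
    (𝓕 (fun m : ZMod (k + 1) => (sinSeq k n m : ℂ)) (-j)).re =
      (𝓕 (fun m : ZMod (k + 1) => (sinSeq k n m : ℂ)) j).re := by
  have heven : Function.Even (fun m : ZMod (k + 1) => (sinSeq k n m : ℂ)) :=
    fun m => by simp [sinSeq_neg k n m]
  rw [(dft_even_iff.2 heven) j]

/-- the sign of `det circulant(sinSeq)` with `k + 1 = 2u` and exponent `2p ≥ 2u`, given that the
determinant is non-zero. -/
theorem det_circulant_sinSeq_sign_even {k u p : ℕ} (hk : k + 1 = 2 * u) (hu : 1 ≤ u) (hup : u ≤ p)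
    (hC : (Matrix.circulant (sinSeq k (2 * p))).det ≠ 0) :
    0 < (-1 : ℝ) ^ u * (Matrix.circulant (sinSeq k (2 * p))).det := by
  have hdetC := det_circulant_real_even (sinSeq k (2 * p)) (sinSeq_neg k (2 * p))
  have hne : ∀ j, (𝓕 (fun m : ZMod (k + 1) => (sinSeq k (2 * p) m : ℂ)) j).re ≠ 0 := by
    intro j hj; apply hC; rw [hdetC]; exact Finset.prod_eq_zero (mem_univ j) hj
  have h0 : 0 < (𝓕 (fun m : ZMod (k + 1) => (sinSeq k (2 * p) m : ℂ)) 0).re := by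
    rw [dft_apply_zero, ← Complex.ofReal_sum, Complex.ofReal_re]
    exact sum_sinSeq_pos k (2 * p) (even_two_mul p) (by omega)
  obtain ⟨c, hc, hmid⟩ := dft_sinSeq_middle (p := p) hk hup
  rw [hdetC, prod_eq_of_even_evenN hk hu (fun j => (𝓕 (fun m : ZMod (k + 1) => (sinSeq k (2 * p) m : ℂ)) j).re)
    (dft_sinSeq_re_even k (2 * p)), hmid]
  have hQ : ∏ j ∈ (univ : Finset (ZMod (k + 1))).filter (fun j => 1 ≤ j.val ∧ j.val ≤ u - 1),
      (𝓕 (fun m : ZMod (k + 1) => (sinSeq k (2 * p) m : ℂ)) j).re ≠ 0 :=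
    Finset.prod_ne_zero_iff.2 fun j _ => hne j
  generalize hA : (𝓕 (fun m : ZMod (k + 1) => (sinSeq k (2 * p) m : ℂ)) 0).re = A at h0 ⊢
  generalize hQ' : ∏ j ∈ (univ : Finset (ZMod (k + 1))).filter (fun j => 1 ≤ j.val ∧ j.val ≤ u - 1),
      (𝓕 (fun m : ZMod (k + 1) => (sinSeq k (2 * p) m : ℂ)) j).re = Q at hQ ⊢
  have h1 : (-1 : ℝ) ^ u * (-1) ^ u = 1 := by
    rw [← pow_add, ← two_mul]; exact (even_two_mul u).neg_one_pow
  have : (-1 : ℝ) ^ u * (A * ((-1) ^ u * c) * (Q * Q)) = ((-1 : ℝ) ^ u * (-1) ^ u) * (A * c * (Q * Q)) := by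
    ring
  rw [this, h1, one_mul]
  exact mul_pos (mul_pos h0 hc) (mul_self_pos.2 hQ)

open Matrix in
/-- the sign of `det G_n` at the cot configuration with `k + 1 = 2u` nodes, `n = 2p ≥ 2u − 1`. -/
theorem det_gram_cotConfig_sign_even {k u p : ℕ} (hk : k + 1 = 2 * u) (hu : 1 ≤ u) (hup : u ≤ p) :
    0 < (-1 : ℝ) ^ u * (gram (2 * p) (cotConfig k)).det := by
  have hn : Even (2 * p) := even_two_mul p
  have hdetne : (gram (2 * p) (cotConfig k)).det ≠ 0 :=
    det_gram_ne_zero_even hn (by omega) (by omega) (cotConfig_strictMono k)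
  have hD : 0 < ∏ j, dScale k (2 * p) j := Finset.prod_pos fun j _ => dScale_pos k (2 * p) j
  rw [det_gram_cotConfig k (2 * p) hn] at hdetne ⊢
  have hC : (Matrix.circulant (sinSeq k (2 * p))).det ≠ 0 := by
    intro h; apply hdetne; rw [h, mul_zero, zero_mul]
  have hsign := det_circulant_sinSeq_sign_even hk hu hup hC
  have : (-1 : ℝ) ^ u * ((∏ j, dScale k (2 * p) j) * (Matrix.circulant (sinSeq k (2 * p))).det *
      ∏ j, dScale k (2 * p) j) =
      ((-1 : ℝ) ^ u * (Matrix.circulant (sinSeq k (2 * p))).det) *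
        ((∏ j, dScale k (2 * p) j) * ∏ j, dScale k (2 * p) j) := by ring
  rw [this]
  positivity

/-- **THEOREM A′, sign part at even ρ**: `n` even, `ρ = 2u`, `2 ≤ ρ ≤ n + 1`, distinct increasing
real atoms ⇒ `(−1)^u · det ((x_i − x_j)^n) > 0` (negative iff `ρ ≡ 2 (mod 4)`). -/
theorem det_gram_sign_even {n ρ u : ℕ} (hn : Even n) (hρ : ρ = 2 * u) (hu : 1 ≤ u)
    (hρn : ρ ≤ n + 1) {x : Fin ρ → ℝ} (hx : StrictMono x) :
    0 < (-1 : ℝ) ^ u * (gram n x).det := by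
  obtain ⟨p, hp⟩ := hn
  have hnp : n = 2 * p := by omega
  subst hnp
  obtain ⟨k, rfl⟩ : ∃ k, ρ = k + 1 := ⟨ρ - 1, by omega⟩
  have hk : k + 1 = 2 * u := hρ
  have hup : u ≤ p := by omega
  have hne : ∀ y : Fin (k + 1) → ℝ, StrictMono y → (gram (2 * p) y).det ≠ 0 :=
    fun y hy => det_gram_ne_zero_even (even_two_mul p) (by omega) hρn hy
  have h0 := det_gram_cotConfig_sign_even hk hu hup
  rcases Nat.even_or_odd u with heu | hou
  · rw [heu.neg_one_pow, one_mul] at h0 ⊢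
    exact det_gram_pos_of_pos_at hne (cotConfig_strictMono k) hx h0
  · rw [hou.neg_one_pow, neg_one_mul, neg_pos] at h0 ⊢
    by_contra hge
    have hpos : 0 < (gram (2 * p) x).det := lt_of_le_of_ne (not_lt.1 hge) (hne x hx).symm
    have := det_gram_pos_of_pos_at hne hx (cotConfig_strictMono k) hpos
    linarith
/-- `ρ ≡ 0 (mod 4)` ⇒ `det > 0`. -/
theorem det_gram_pos_of_four_dvd {n ρ : ℕ} (hn : Even n) (h4 : 4 ∣ ρ) (hρ : 2 ≤ ρ)
    (hρn : ρ ≤ n + 1) {x : Fin ρ → ℝ} (hx : StrictMono x) : 0 < (gram n x).det := by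
  obtain ⟨w, hw⟩ := h4
  have h := det_gram_sign_even (u := 2 * w) hn (by omega) (by omega) hρn hx
  rwa [(even_two_mul w).neg_one_pow, one_mul] at h
/-- `ρ ≡ 2 (mod 4)` ⇒ `det < 0`. -/
theorem det_gram_neg_of_two_mod_four {n ρ : ℕ} (hn : Even n) (h2 : ρ % 4 = 2)
    (hρn : ρ ≤ n + 1) {x : Fin ρ → ℝ} (hx : StrictMono x) : (gram n x).det < 0 := by
  have h := det_gram_sign_even (u := 2 * (ρ / 4) + 1) hn (by omega) (by omega) hρn hx
  have hodd : Odd (2 * (ρ / 4) + 1) := ⟨ρ / 4, rfl⟩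
  rw [hodd.neg_one_pow, neg_one_mul, neg_pos] at h
  exact h


/-! ### THEOREM A packaged (all `n ≥ 1`, all `1 ≤ ρ ≤ n + 1`) -/
/-- the one-atom Gram matrix is zero: rank `0` (`n ≥ 1`). -/
theorem rank_gram_one {n : ℕ} (hn : 1 ≤ n) (x : Fin 1 → ℝ) : (gram n x).rank = 0 := by
  have : gram n x = 0 := by
    ext i j
    have hij : i = j := Subsingleton.elim _ _
    simp [gram, hij, zero_pow (by omega : n ≠ 0)]
  rw [this, Matrix.rank_zero]

/-- **THEOREM A (FORMULA-N PART A §2.9), packaged.** For `n ≥ 1`, `1 ≤ ρ ≤ n + 1` and distinct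
increasing real atoms, the rank of `((x_i − x_j)^n)_{i,j<ρ}` is `ρ − [ρ = 1]` if `n` is even and
`2⌊ρ/2⌋` if `n` is odd. -/
theorem apolarGram_rank {n ρ : ℕ} (hn : 1 ≤ n) (hρ : 1 ≤ ρ) (hρn : ρ ≤ n + 1)
    {x : Fin ρ → ℝ} (hx : StrictMono x) :
    (gram n x).rank = if Even n then ρ - (if ρ = 1 then 1 else 0) else 2 * (ρ / 2) := by
  by_cases h1 : ρ = 1
  · subst h1
    rw [rank_gram_one hn x]
    simp
  have hρ2 : 2 ≤ ρ := by omega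
  rcases Nat.even_or_odd n with he | ho
  · rw [if_pos he, if_neg h1, Nat.sub_zero]
    exact rank_gram_even he hρ2 hρn hx
  · rw [if_neg (Nat.not_even_iff_odd.2 ho)]
    rcases Nat.even_or_odd ρ with hρe | hρo
    · rw [rank_gram_eq hρ2 hρn (by rcases ho with ⟨a, ha⟩; rcases hρe with ⟨b, hb⟩; omega) hx]
      rcases hρe with ⟨b, hb⟩; omega
    · obtain ⟨r, rfl⟩ : ∃ r, ρ = r + 1 := ⟨ρ - 1, by omega⟩
      have h3 : 3 ≤ r + 1 := by rcases hρo with ⟨b, hb⟩; omega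
      rw [rank_gram_eq_of_odd ho hρo h3 hρn hx]
      rcases hρo with ⟨b, hb⟩; omega

end Summit.Ventures.HSemireg.ApolarGram
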